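import Literature.AnabelianGeometry.SemiGraphs.ArithQuasiGeometricSurjective
import Literature.AnabelianGeometry.SemiGraphs.ArithIntersectionWithGeometricProofs
import HarnessLib

/-!
# [SemiAnbd] Theorem 5.4 (iii), clause 3 (surjectivity) under the COMPATIBLE reading — the
# ARITHMETIC-indexed variant of the repaired junction binder `hCor39c` (row T54-7c; proof-only)

Mochizuki, *Semi-graphs of anabelioids*, Publ. RIMS **42** (2006), §5, Theorem 5.4 (iii), manuscript
p. 66 [cite: MochizukiSemiAnbd2006, Thm 5.4 (iii), p. 66]: "the proofs are entirely parallel to those of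
Theorem 3.7, Corollary 3.9".

PROOF-ONLY companion (cell abc-iut, layer L3; L3-lead rulings α13-4 / α14-2 «T54-7c» and α19-2 (iii)
«the arithmetic-indexed variant COEXISTS under a new path», seat abc-iut-w4-d083) of abc-iut-w5-d141's
`ArithQuasiGeometricSurjective.lean` (row T54-7; Steps A, C, D, E reused BY NAME, file untouched).  The
file OF RECORD for the repair of FINDING W4d083-F2 is abc-iut-w5-d141's
`ArithQuasiGeometricSurjectiveCompat.lean` (`Thm54iii.clause3Compat_of_geometric`, GEOMETRIC-indexed
`hCor39c`: its third antecedent is stated on the geometric parts `· ∩ Ker`, derived there from the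
arithmetic compatibility clause with the producer input `hadj`).  THIS file is the ARITHMETIC-indexed
variant, kept because it needs ZERO new inputs on the Thm 5.4 side (the bridge to the geometric parts is
pushed to the producer's junction): FINDING W4d083-F2 — the binder `hCor39` of
`Thm54iii.clause3_of_geometric` is the LITERAL Cor. 3.9 (b) at the kernels (∃-targets chosen
independently per vertex / per branch), not derivable from the tree's COMPATIBLE geometric Cor. 3.9 (b)
(`exists_hom_chartPullbackWith_iso_of_isCompatiblyQuasiGeometric(At)`, abc-iut-w4-d080, over (R2′)
`exists_hom_of_isQuasiGeometric_of_compat(At)`, abc-iut-w4-d083): under the literal Def. 3.8 the "fold"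
`Π_{v₁} *_{Π_e} Π_{v₂} → Π_w` satisfies every per-vertex / per-branch shadow condition and is induced by no
morphism of graphs (findings W4d083-F1 / t2g2-F1, ruling χ2, O-Cor39-1); likewise the 4th conjunct of
`IsArithQuasiGeometric` does not say that `K₁`, `H₁` go into `K₂`, `H₂` RESPECTIVELY (O-T54-1).  Contents
(no definition):
* `arithCompatShadow_of_compat` (Step A′, arithmetic-indexed): Thm 5.4 (ii) on both sides turns the
  ARITHMETIC compatibility clause for `f` into its shadow on the data of p. 65
  (`conjSubgroup yᵢ (D.vertGp vᵢ)` ↦ distinct `conjSubgroup xᵢ (D'.vertGp wᵢ)`), no further input;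
* `Thm54iii.clause3_of_geometric_compat`: d141's assembly VERBATIM with `hCor39` replaced by the
  arithmetic-indexed `hCor39c` (third antecedent = that shadow) and the conclusion for the `f` satisfying
  the compatibility clause (= `IsArithCompatiblyQuasiGeometric`'s second conjunct, `ArithQuasiGeometricCompat.lean`);
* `inf_ker_ne_of_isVerticial_ne` (junction helper, from abc-iut-w4-d040's `isVerticial_eq_of_inf_ker_eq`):
  distinct verticial subgroups have distinct geometric parts — the target-side half of turning the
  arithmetic-indexed third antecedent into `IsCompatiblyQuasiGeometric.compat` for `f|_{Ker augG}`; the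
  source-side half (distinct geometric verticial parts meeting non-trivially ⇒ arithmetically ample
  intersection of their commensurators) is the producer's `hadj`-type input, needed at the junction here
  instead of inside Step A′.
Nothing asserted for real tempered data; nothing here bears on [IUTchIII] Cor. 3.12; typed ≠ proved.
-/

namespace Literature.AnabelianGeometry.SemiGraphs

open _root_.CategoryTheory

universe u v w uG uH uP uV uB uV' uB'

/-! ### Step A′ — the compatibility clause and its shadow on the data of p. 65 -/

section StepA'

variable {Gtp : Type uG} [Group Gtp] [TopologicalSpace Gtp]
variable {Htp : Type uH} [Group Htp] [TopologicalSpace Htp]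
variable {PA : Type uP} [Group PA] [TopologicalSpace PA]
variable {V : Type uV} {B : Type uB} {V' : Type uV'} {B' : Type uB'}
variable {D : DecompositionData Gtp V B} {D' : DecompositionData Htp V' B'}
variable {augG : Gtp →* PA} {augH' : Htp →* PA} {f : Gtp →* Htp}

/-- **Step A′ (the compatible reading).** If `f` carries distinct arithmetically maximal compact subgroups
`K₁ ≠ H₁` with arithmetically ample intersection into distinct arithmetically maximal compact subgroups
`K₂ ≠ H₂` RESPECTIVELY (the χ2 compatibility clause, arithmetic form), then — Thm 5.4 (ii) on both sides
turning "arithmetically maximal compact" into "verticial" — distinct verticial representatives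
`y₁·Π^temp_{𝔊,v₁}·y₁⁻¹ ≠ y₂·Π^temp_{𝔊,v₂}·y₂⁻¹` with arithmetically ample intersection go into distinct
verticial `x₁·Π^temp_{ℍ,w₁}·x₁⁻¹ ≠ x₂·Π^temp_{ℍ,w₂}·x₂⁻¹`, respectively.
[cite: MochizukiSemiAnbd2006, Thm 5.4 (iii), p. 66] -/
theorem arithCompatShadow_of_compat (hIIG : ArithMaximalCompactStatementII D augG)
    (hIIH : ArithMaximalCompactStatementII D' augH')
    (hfc : ∀ K₁ H₁ : Subgroup Gtp, IsArithMaximalCompact augG K₁ → IsArithMaximalCompact augG H₁ →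
      K₁ ≠ H₁ → IsArithAmple augG (K₁ ⊓ H₁) →
        ∃ K₂ H₂ : Subgroup Htp, IsArithMaximalCompact augH' K₂ ∧ IsArithMaximalCompact augH' H₂ ∧
          K₂ ≠ H₂ ∧ K₁.map f ≤ K₂ ∧ H₁.map f ≤ H₂) :
    ∀ (v₁ v₂ : V) (y₁ y₂ : Gtp), conjSubgroup y₁ (D.vertGp v₁) ≠ conjSubgroup y₂ (D.vertGp v₂) →
      IsArithAmple augG (conjSubgroup y₁ (D.vertGp v₁) ⊓ conjSubgroup y₂ (D.vertGp v₂)) →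
      ∃ (w₁ w₂ : V') (x₁ x₂ : Htp),
        conjSubgroup x₁ (D'.vertGp w₁) ≠ conjSubgroup x₂ (D'.vertGp w₂) ∧
        (conjSubgroup y₁ (D.vertGp v₁)).map f ≤ conjSubgroup x₁ (D'.vertGp w₁) ∧
        (conjSubgroup y₂ (D.vertGp v₂)).map f ≤ conjSubgroup x₂ (D'.vertGp w₂) := by
  intro v₁ v₂ y₁ y₂ hne hamp
  have hK₁ : IsArithMaximalCompact augG (conjSubgroup y₁ (D.vertGp v₁)) := (hIIG.1 _).mpr ⟨v₁, y₁, rfl⟩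
  have hH₁ : IsArithMaximalCompact augG (conjSubgroup y₂ (D.vertGp v₂)) := (hIIG.1 _).mpr ⟨v₂, y₂, rfl⟩
  obtain ⟨K₂, H₂, hK₂, hH₂, hne₂, hle₁, hle₂⟩ := hfc _ _ hK₁ hH₁ hne hamp
  obtain ⟨w₁, x₁, rfl⟩ := (hIIH.1 K₂).mp hK₂
  obtain ⟨w₂, x₂, rfl⟩ := (hIIH.1 H₂).mp hH₂
  exact ⟨w₁, w₂, x₁, x₂, hne₂, hle₁, hle₂⟩

omit [TopologicalSpace Gtp] [TopologicalSpace PA] in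
/-- **Junction helper (target side of the dictionary).** Distinct verticial subgroups of `Π^temp_𝔊` have
distinct GEOMETRIC parts `· ∩ Ker aug` — the commensurator description of p. 65 (`Π^temp_{𝔊,v}` is the
commensurator of `Π^temp_{𝔾,v}`; abc-iut-w4-d040's `isVerticial_eq_of_inf_ker_eq`).  At `ℍ` this turns the
distinct verticial targets of the third antecedent of `hCor39c` into distinct maximal compact subgroups of
`Π^temp_ℍ|_{geom} = Ker augH'`, i.e. into the clause `IsCompatiblyQuasiGeometric.compat` for `f|_{Ker augG}`.
[cite: MochizukiSemiAnbd2006, §5, p. 65] -/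
theorem inf_ker_ne_of_isVerticial_ne
    (hcomm : ∀ v : V, Subgroup.Commensurable.commensurator (D.vertGp v ⊓ augG.ker) = D.vertGp v)
    {W W' : Subgroup Gtp} (hW : IsVerticial D W) (hW' : IsVerticial D W') (hne : W ≠ W') :
    W ⊓ augG.ker ≠ W' ⊓ augG.ker :=
  fun h => hne (isVerticial_eq_of_inf_ker_eq D augG hcomm hW hW' h)

end StepA'

/-! ### Clause 3 under the compatible reading -/

section Main

variable {Obj : Type u} [Category.{v} Obj] {𝓥 : SemiAnbdVocab.{u, v, w} Obj}
variable {𝔊 ℍ : ArithSemiGraph 𝓥} {e : 𝔊.PA ≃* ℍ.PA}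
variable {Gtp : Type uG} [Group Gtp] [TopologicalSpace Gtp]
variable {Htp : Type uH} [Group Htp] [TopologicalSpace Htp]
variable {V : Type uV} {B : Type uB} {V' : Type uV'} {B' : Type uB'}
variable {D : DecompositionData Gtp V B} {D' : DecompositionData Htp V' B'}

/-- **[SemiAnbd] Theorem 5.4 (iii), clause 3 (surjectivity), COMPATIBLE READING — row T54-7c.**  Every
continuous, arithmetically quasi-geometric `f : Π^temp_𝔊 → Π^temp_ℍ` over `A` WHICH MOREOVER SATISFIES THE
COMPATIBILITY CLAUSE (distinct arithmetically maximal compact `K₁ ≠ H₁` with arithmetically ample `K₁ ∩ H₁`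
go into distinct arithmetically maximal compact `K₂ ≠ H₂`, respectively — the χ2 reading of Def. 3.8
transported to §5) arises, up to an inner automorphism of `Π^temp_ℍ`, from a locally open morphism `𝔊 → ℍ`
over `A`.  Identical to abc-iut-w5-d141's `Thm54iii.clause3_of_geometric` (Steps A, C, D, E reused by name)
except that the undischargeable literal junction binder `hCor39` is replaced by the compat-augmented
**`hCor39c`**: the geometric Cor. 3.9 (b) at the kernels WITH, as a third antecedent, the shadow of the
compatibility clause on the data of p. 65 (supplied by `arithCompatShadow_of_compat`).  JUNCTION RECIPE for
discharging `hCor39c` (producer T54-B): read antecedent 1 as `IsQuasiGeometric.maximal` for `f|_{Ker augG}`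
through the tempered charts (Thm 3.7 (iv) at `𝔾`, `ℍ`: maximal compact = verticial; `D.vertGp v ∩ Ker augG`
= a geometric verticial subgroup, abc-iut-w4-d040 `decompositionDataOfChart_vertGp_inf_ker`), antecedent 3 as
`IsCompatiblyQuasiGeometric.compat` (source side: two distinct geometric verticial subgroups meeting
non-trivially have DISTINCT verticial commensurators — `inf_ker_ne_of_isVerticial_ne` contraposed is
trivial — whose intersection contains the arithmetic edge-like subgroup of the edge joining them (Thm 3.7
(iii)/(iv) at `𝔾` + Thm 5.4 (ii)), hence is arithmetically ample; target side: `inf_ker_ne_of_isVerticial_ne`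
at `ℍ`), and `IsQuasiGeometric.inter` from antecedents 2–3; then apply
`exists_hom_chartPullbackWith_iso_of_isCompatiblyQuasiGeometric` (mod `CompactInVerticial`; per-graph:
abc-iut-w4-d080's `cor39UpToTwistAt`) and unfold the twisted chart pullback by Prop. 3.6 (iv).
[cite: MochizukiSemiAnbd2006, Thm 5.4 (iii), p. 66] -/
theorem Thm54iii.clause3_of_geometric_compat (augG : Gtp →* 𝔊.PA) (augH' : Htp →* 𝔊.PA)
    (btemp : (φ : ArithHom 𝓥 𝔊 ℍ) → φ.IsLocallyOpen → ArithHom.IsOverA 𝔊 ℍ e φ → (Gtp →* Htp))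
    (hIIG : ArithMaximalCompactStatementII D augG) (hIIH : ArithMaximalCompactStatementII D' augH')
    (hover : ∀ (φ : ArithHom 𝓥 𝔊 ℍ) (h₁ : φ.IsLocallyOpen) (h₂ : ArithHom.IsOverA 𝔊 ℍ e φ),
      augH'.comp (btemp φ h₁ h₂) = augG)
    (ι : (𝔊.G ⟶ ℍ.G) → (augG.ker →* Htp))
    (hιG : ∀ (g : 𝔊.G ⟶ ℍ.G) (a : 𝔊.PA) (γ : Gtp), augG γ = a → ∃ δ ∈ augH'.ker,
      ∀ x : augG.ker, ι ((𝔊.ρ a).hom ≫ g) x =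
        δ * ι g ⟨γ * x * γ⁻¹, (MonoidHom.normal_ker augG).conj_mem _ x.2 γ⟩ * δ⁻¹)
    (hιH : ∀ (g : 𝔊.G ⟶ ℍ.G) (a : 𝔊.PA) (η : Htp), augH' η = a → ∃ δ ∈ augH'.ker,
      ∀ x : augG.ker, ι (g ≫ (ℍ.ρ (e a)).hom) x = δ * (η * ι g x * η⁻¹) * δ⁻¹)
    (hιinj : ∀ g₁ g₂ : 𝔊.G ⟶ ℍ.G,
      (∃ δ ∈ augH'.ker, ∀ x : augG.ker, ι g₁ x = δ * ι g₂ x * δ⁻¹) → g₁ = g₂)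
    (hιbtemp : ∀ (φ : ArithHom 𝓥 𝔊 ℍ) (h₁ : φ.IsLocallyOpen) (h₂ : ArithHom.IsOverA 𝔊 ℍ e φ),
      ∃ δ ∈ augH'.ker, ∀ x : augG.ker, btemp φ h₁ h₂ x = δ * ι φ.geom x * δ⁻¹)
    (hCor39c : ∀ f : Gtp →* Htp, Continuous f → augH'.comp f = augG →
      (∀ v : V, ∃ (w : V') (x : Htp),
        MapsOntoOpenSubgroupOf f (D.vertGp v ⊓ augG.ker) (conjSubgroup x (D'.vertGp w) ⊓ augH'.ker)) →
      (∀ b : B, ∃ (b' : B') (x : Htp),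
        MapsOntoOpenSubgroupOf f (D.brGp b ⊓ augG.ker) (conjSubgroup x (D'.brGp b') ⊓ augH'.ker)) →
      (∀ (v₁ v₂ : V) (y₁ y₂ : Gtp), conjSubgroup y₁ (D.vertGp v₁) ≠ conjSubgroup y₂ (D.vertGp v₂) →
        IsArithAmple augG (conjSubgroup y₁ (D.vertGp v₁) ⊓ conjSubgroup y₂ (D.vertGp v₂)) →
        ∃ (w₁ w₂ : V') (x₁ x₂ : Htp),
          conjSubgroup x₁ (D'.vertGp w₁) ≠ conjSubgroup x₂ (D'.vertGp w₂) ∧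
          (conjSubgroup y₁ (D.vertGp v₁)).map f ≤ conjSubgroup x₁ (D'.vertGp w₁) ∧
          (conjSubgroup y₂ (D.vertGp v₂)).map f ≤ conjSubgroup x₂ (D'.vertGp w₂)) →
      ∃ (g : 𝔊.G ⟶ ℍ.G), ∃ h ∈ augH'.ker, ∀ x : augG.ker, f x = h * ι g x * h⁻¹)
    (hZ : ∀ (w : V') (x : Htp) (U : Subgroup Htp), U ≤ conjSubgroup x (D'.vertGp w) ⊓ augH'.ker →
      IsOpen ((Subtype.val : (conjSubgroup x (D'.vertGp w) ⊓ augH'.ker : Subgroup Htp) → Htp) ⁻¹'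
        (U : Set Htp)) →
      ∀ z ∈ augH'.ker, (∀ u ∈ U, z * u = u * z) → z = 1)
    (hsurjG : Function.Surjective augG) (he : Continuous e) (hV : Nonempty V) :
    ∀ f : Gtp →* Htp, IsArithQuasiGeometric augG augH' f →
      (∀ K₁ H₁ : Subgroup Gtp, IsArithMaximalCompact augG K₁ → IsArithMaximalCompact augG H₁ →
        K₁ ≠ H₁ → IsArithAmple augG (K₁ ⊓ H₁) →
          ∃ K₂ H₂ : Subgroup Htp, IsArithMaximalCompact augH' K₂ ∧ IsArithMaximalCompact augH' H₂ ∧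
            K₂ ≠ H₂ ∧ K₁.map f ≤ K₂ ∧ H₁.map f ≤ H₂) →
      ∃ (φ : ArithHom 𝓥 𝔊 ℍ) (h₁ : φ.IsLocallyOpen) (h₂ : ArithHom.IsOverA 𝔊 ℍ e φ) (h : Htp),
        ∀ g, f g = h * btemp φ h₁ h₂ g * h⁻¹ := by
  intro f hf hfc
  -- Step A + Step A′ + Step B: the geometric morphism (compatible reading)
  obtain ⟨g, h, hh, hfg⟩ := hCor39c f hf.1 hf.2.1
    (fun v => by
      obtain ⟨w, x, -, hgeo⟩ := geomShadowV_of_isArithQuasiGeometric hIIG hIIH hf v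
      exact ⟨w, x, hgeo⟩)
    (fun b => by
      obtain ⟨b', x, -, hgeo⟩ := geomShadowE_of_isArithQuasiGeometric hIIG hIIH hf b
      exact ⟨b', x, hgeo⟩)
    (arithCompatShadow_of_compat hIIG hIIH hfc)
  -- Step C: equivariance, hence an arithmetic morphism `φ = (e, g)` over `A`
  have hcompat : ∀ a : 𝔊.PA, (𝔊.ρ a).hom ≫ g = g ≫ (ℍ.ρ (e.toMonoidHom a)).hom := fun a =>
    geom_compat_of_over ι hιG hιH hιinj hsurjG hf.2.1 hh hfg a
  let φ : ArithHom 𝓥 𝔊 ℍ :=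
    { arith := e.toMonoidHom, continuous_arith := he, geom := g, compat := hcompat }
  have h₁ : φ.IsLocallyOpen := by
    show IsOpen (Set.range (e.toMonoidHom : 𝔊.PA → ℍ.PA))
    have hr : Set.range (e.toMonoidHom : 𝔊.PA → ℍ.PA) = Set.univ := by
      rw [MulEquiv.coe_toMonoidHom]
      exact Set.range_eq_univ.mpr e.surjective
    rw [hr]
    exact isOpen_univ
  have h₂ : ArithHom.IsOverA 𝔊 ℍ e φ := fun a => rfl
  -- Step D: agreement on the kernel with a conjugate of `btemp φ`
  obtain ⟨δ, hδ, hbt⟩ := hιbtemp φ h₁ h₂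
  have hk : h * δ⁻¹ ∈ augH'.ker := augH'.ker.mul_mem hh (augH'.ker.inv_mem hδ)
  have hagree : ∀ x ∈ augG.ker,
      f x = (MulAut.conj (h * δ⁻¹)).toMonoidHom.comp (btemp φ h₁ h₂) x := by
    intro x hx
    have e1 := hfg ⟨x, hx⟩
    have e2 := hbt ⟨x, hx⟩
    change btemp φ h₁ h₂ x = δ * ι g ⟨x, hx⟩ * δ⁻¹ at e2
    change f x = h * ι g ⟨x, hx⟩ * h⁻¹ at e1
    change f x = (h * δ⁻¹) * btemp φ h₁ h₂ x * (h * δ⁻¹)⁻¹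
    rw [e1, e2]
    group
  -- Step E: the two homomorphisms over `A` agree everywhere
  refine ⟨φ, h₁, h₂, h * δ⁻¹, fun γ => ?_⟩
  obtain ⟨v₀⟩ := hV
  obtain ⟨w, x, -, hU⟩ := geomShadowV_of_isArithQuasiGeometric hIIG hIIH hf v₀
  have hF : augH'.comp ((MulAut.conj (h * δ⁻¹)).toMonoidHom.comp (btemp φ h₁ h₂)) = augG := by
    ext y
    have hk1 : augH' (h * δ⁻¹) = 1 := hk
    have hy := congrArg (fun ψ : Gtp →* 𝔊.PA => ψ y) (hover φ h₁ h₂)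
    simp only [MonoidHom.comp_apply] at hy ⊢
    rw [MulEquiv.coe_toMonoidHom, MulAut.conj_apply, map_mul, map_mul, map_inv, hk1, hy, one_mul,
      inv_one, mul_one]
  have key := eq_of_kerAgree_of_centralizer hf.2.1 hF hagree (D.vertGp v₀ ⊓ augG.ker) inf_le_right
    (hZ w x _ hU.1 hU.2) γ
  rw [key]
  rfl

end Main

end Literature.AnabelianGeometry.SemiGraphs
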